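import Literature.MathematicalPhysics.KineticTheory.InfiniteChainBoundaryTransferForm
import Literature.Analysis.OperatorTheory.KernelIterateBridge
import HarnessLib

/-!
# The window operator of an interval Gibbs integral as a bounded positive kernel

Topic `Literature/MathematicalPhysics/KineticTheory`; theorems only (no definitions, no named
facts). Sequel of `InfiniteChainBoundaryTransferForm.lean`, where the un-normalised Gibbs integral
of a window observable `F` (window `{c, …, d}`, `c < d`) over the interval `{c-n, …, d+n}` is
written as `(T^{n+1} M_F T^{n} k_v)(u)` with the window operator
`(M_F ψ)(x) = (∫⋯∫⁻_{c<y≤d} F · ∏_{c<y≤d} w(σ_y)k(σ_{y-1},σ_y) · ψ(σ_d))(σ_c := x)`.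
Here `M_F` is shown to be an integral operator against the one-site a priori weight,
`(M_F ψ)(x) = ∫ m_F(x,y) w(y) ψ(y) dy`, with the WINDOW KERNEL

  `m_F(x,y) = (∫⋯∫⁻_{c<y'<d} F · ∏_{c<y'<d} w(σ_{y'})k(σ_{y'-1},σ_{y'}) · k(σ_{d-1}, σ_d))(σ_c := x, σ_d := y)`,

which is jointly measurable, bounded by `(∫ w)^{#\{c<y'<d\}}` when `F ≤ 1` and `k ≤ 1`, and
everywhere positive when `F`, `k`, `w` are (Georgii 2011, Ch. 10–11; the matrix elements of the
"decorated" transfer matrix of Baxter 1982, §2). These are the hypotheses under which the window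
operator has a bounded `L²` realisation (`Literature.Analysis.OperatorTheory.exists_kernelOp`) in the
uniqueness proof for one-dimensional chains. As before `k`, `w`, `TM`, `MK` are VARIABLES constrained
by hypotheses; no definition is introduced.

* `lmarginal_prod_eq_pow` — `∫⋯∫⁻_s ∏_{y∈s} g(σ_y) = (∫ g)^{#s}`;
* `measurable_update_update` — `(x, y) ↦ η₀[c ↦ x][d ↦ y]` is measurable;
* `windowOp_eq_lintegral_windowKernel` — `(M_F ψ)(x) = ∫ m_F(x,y) w(y) ψ(y) dy`;
* `measurable_windowKernel`, `windowKernel_le_pow`, `windowKernel_pos`;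
* `lintegral_kernel_weight_ofReal_eq`, `iterate_transfer_ofReal_eq` — the bridge from the
  `ℝ≥0∞` transfer map `(T f)(z) = ∫⁻ k(z,y) w(y) f(y) dy` (Lebesgue measure, weight inside) to the
  real kernel operator `(κ g)(x) = ∫ K(x,y) g(y) dρ(y)` on the FINITE a priori measure `ρ = w · Leb`
  (`Literature.Analysis.OperatorTheory.KernelIterateBridge`): for `k = ofReal ∘ K`, `K ≥ 0` bounded
  jointly measurable and `f ≥ 0` bounded measurable, `T (ofReal ∘ f) = ofReal ∘ κ f` and
  `T^[j] (ofReal ∘ f) = ofReal ∘ κ^[j] f` with `κ^[j] f ≥ 0`.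

[cite: Georgii2011, Thm 10.25 and §11.1]
-/

noncomputable section

open MeasureTheory Set Function Filter Finset Literature.Probability.LatticeModels
open scoped ENNReal

namespace Literature.MathematicalPhysics.KineticTheory.HeatConduction

namespace OscillatorChain

/-! ### Two helpers -/

/-- `∫⋯∫⁻_s ∏_{y ∈ s} g(σ_y) = (∫ g)^{#s}` for a measurable one-site function `g`. [folklore] -/
theorem lmarginal_prod_eq_pow {g : ℝ × ℝ → ℝ≥0∞} (hg : Measurable g) (s : Finset ℤ)
    (η : ChainConfig) :
    (∫⋯∫⁻_s, (fun σ : ChainConfig => ∏ y ∈ s, g (σ y)) ∂fun _ : ℤ => (volume : Measure (ℝ × ℝ))) η =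
      (∫⁻ z, g z) ^ s.card := by
  classical
  induction s using Finset.induction_on generalizing η with
  | empty => simp
  | insert i s hi ih =>
    have hmeas : Measurable fun σ : ChainConfig => ∏ y ∈ insert i s, g (σ y) :=
      Finset.measurable_prod _ fun y _ => hg.comp (measurable_pi_apply _)
    have hmeas' : Measurable fun σ : ChainConfig => ∏ y ∈ s, g (σ y) :=
      Finset.measurable_prod _ fun y _ => hg.comp (measurable_pi_apply _)
    rw [lmarginal_insert' _ hmeas hi]
    have hinner : (fun σ : ChainConfig => ∫⁻ z, ∏ y ∈ insert i s, g ((Function.update σ i z) y)) =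
        fun σ => (∏ y ∈ s, g (σ y)) * ∫⁻ z, g z := by
      funext σ
      have hval : ∀ z, ∏ y ∈ insert i s, g ((Function.update σ i z) y) = (∏ y ∈ s, g (σ y)) * g z := by
        intro z
        rw [Finset.prod_insert hi, Function.update_self, mul_comm]
        congr 1
        refine Finset.prod_congr rfl fun y hy => ?_
        rw [Function.update_of_ne (ne_of_mem_of_not_mem hy hi)]
      simp_rw [hval]
      rw [lintegral_const_mul _ hg]
    rw [hinner, lmarginal_mul_const _ hmeas', ih, Finset.card_insert_of_notMem hi, pow_succ]

/-- The two-site insertion `(x, y) ↦ η₀[c ↦ x][d ↦ y]` is jointly measurable. [folklore] -/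
theorem measurable_update_update (η₀ : ChainConfig) (c d : ℤ) :
    Measurable fun p : (ℝ × ℝ) × (ℝ × ℝ) => Function.update (Function.update η₀ c p.1) d p.2 := by
  refine measurable_pi_lambda _ fun i => ?_
  by_cases hid : i = d
  · subst hid
    simp only [Function.update_self]
    exact measurable_snd
  · simp only [Function.update_of_ne hid]
    by_cases hic : i = c
    · subst hic
      simp only [Function.update_self]
      exact measurable_fst
    · simp only [Function.update_of_ne hic]
      exact measurable_const

/-! ### The window kernel -/

section Window

variable {k : ℝ × ℝ → ℝ × ℝ → ℝ≥0∞} {w : ℝ × ℝ → ℝ≥0∞} {c d : ℤ} {F : ChainConfig → ℝ≥0∞}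
  {η₀ : ChainConfig} {TM : (ℝ × ℝ → ℝ≥0∞) → (ℝ × ℝ → ℝ≥0∞)} {MK : ℝ × ℝ → ℝ × ℝ → ℝ≥0∞}

/-- **The window operator is an integral operator with the window kernel**: for measurable `ψ`,
`(M_F ψ)(x) = ∫ m_F(x, y) w(y) ψ(y) dy`. [cite: Georgii2011, Thm 10.25 and §11.1] -/
theorem windowOp_eq_lintegral_windowKernel (hkm : Measurable (uncurry k)) (hwm : Measurable w)
    (hcd : c < d) (hFm : Measurable F)
    (hTM : ∀ ψ x, TM ψ x = (∫⋯∫⁻_Finset.Icc (c + 1) d, (fun σ => F σ *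
        (∏ y ∈ Finset.Icc (c + 1) d, (w (σ y) * k (σ (y - 1)) (σ y))) * ψ (σ d))
          ∂fun _ : ℤ => (volume : Measure (ℝ × ℝ))) (Function.update η₀ c x))
    (hMK : ∀ x y, MK x y = (∫⋯∫⁻_Finset.Icc (c + 1) (d - 1), (fun σ => F σ *
        (∏ y' ∈ Finset.Icc (c + 1) (d - 1), (w (σ y') * k (σ (y' - 1)) (σ y'))) * k (σ (d - 1)) (σ d))
          ∂fun _ : ℤ => (volume : Measure (ℝ × ℝ)))
            (Function.update (Function.update η₀ c x) d y))
    {ψ : ℝ × ℝ → ℝ≥0∞} (hψ : Measurable ψ) (x : ℝ × ℝ) :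
    TM ψ x = ∫⁻ y, MK x y * w y * ψ y := by
  set t : Finset ℤ := Finset.Icc (c + 1) (d - 1) with ht
  have hsplit : Finset.Icc (c + 1) d = t ∪ {d} := by
    ext y; simp only [ht, Finset.mem_Icc, Finset.mem_union, Finset.mem_singleton]; omega
  have hdisj : Disjoint t {d} := by
    rw [Finset.disjoint_singleton_right]; simp [ht]
  have hnot : d ∉ t := by simp [ht]
  have hins : Finset.Icc (c + 1) d = insert d t := by rw [hsplit, Finset.union_comm]; rfl
  have hWB : ∀ s : Finset ℤ, Measurable fun σ : ChainConfig =>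
      ∏ y ∈ s, (w (σ y) * k (σ (y - 1)) (σ y)) := fun s => measurable_blockWeight hkm hwm s
  -- the integrand, with the site `d` split off
  have hfun : (fun σ : ChainConfig => F σ *
      (∏ y ∈ Finset.Icc (c + 1) d, (w (σ y) * k (σ (y - 1)) (σ y))) * ψ (σ d)) =
      fun σ => (F σ * (∏ y' ∈ t, (w (σ y') * k (σ (y' - 1)) (σ y'))) * k (σ (d - 1)) (σ d)) *
        (w (σ d) * ψ (σ d)) := by
    funext σ
    rw [hins, Finset.prod_insert hnot]
    ring
  have hcore : Measurable fun σ : ChainConfig =>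
      F σ * (∏ y' ∈ t, (w (σ y') * k (σ (y' - 1)) (σ y'))) * k (σ (d - 1)) (σ d) :=
    (hFm.mul (hWB t)).mul (measurable_kernel_eval hkm _ _)
  have htail : Measurable fun σ : ChainConfig => w (σ d) * ψ (σ d) :=
    (measurable_comp_eval hwm d).mul (hψ.comp (measurable_pi_apply d))
  have hfm : Measurable fun σ : ChainConfig =>
      (F σ * (∏ y' ∈ t, (w (σ y') * k (σ (y' - 1)) (σ y'))) * k (σ (d - 1)) (σ d)) *
        (w (σ d) * ψ (σ d)) := hcore.mul htail
  have hdep : DependsOn (fun σ : ChainConfig => w (σ d) * ψ (σ d)) (↑({d} : Finset ℤ) : Set ℤ) := by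
    intro σ σ' hσ
    have h1 : σ d = σ' d := hσ d (by simp)
    simp only [h1]
  rw [hTM, hfun, hsplit, lmarginal_union' _ _ hfm hdisj, lmarginal_singleton]
  refine lintegral_congr fun y => ?_
  rw [lmarginal_mul_right_of_dependsOn' hdep hdisj hcore, hMK, Function.update_self]
  ring

/-- The window kernel is jointly measurable. [folklore] -/
theorem measurable_windowKernel (hkm : Measurable (uncurry k)) (hwm : Measurable w)
    (hFm : Measurable F)
    (hMK : ∀ x y, MK x y = (∫⋯∫⁻_Finset.Icc (c + 1) (d - 1), (fun σ => F σ *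
        (∏ y' ∈ Finset.Icc (c + 1) (d - 1), (w (σ y') * k (σ (y' - 1)) (σ y'))) * k (σ (d - 1)) (σ d))
          ∂fun _ : ℤ => (volume : Measure (ℝ × ℝ)))
            (Function.update (Function.update η₀ c x) d y)) :
    Measurable (uncurry MK) := by
  have hcore : Measurable fun σ : ChainConfig => F σ *
      (∏ y' ∈ Finset.Icc (c + 1) (d - 1), (w (σ y') * k (σ (y' - 1)) (σ y'))) * k (σ (d - 1)) (σ d) :=
    (hFm.mul (measurable_blockWeight hkm hwm _)).mul (measurable_kernel_eval hkm _ _)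
  have h : uncurry MK = fun p : (ℝ × ℝ) × (ℝ × ℝ) =>
      (∫⋯∫⁻_Finset.Icc (c + 1) (d - 1), (fun σ => F σ *
        (∏ y' ∈ Finset.Icc (c + 1) (d - 1), (w (σ y') * k (σ (y' - 1)) (σ y'))) * k (σ (d - 1)) (σ d))
          ∂fun _ : ℤ => (volume : Measure (ℝ × ℝ)))
            (Function.update (Function.update η₀ c p.1) d p.2) := by
    funext p; exact hMK p.1 p.2
  rw [h]
  exact (hcore.lmarginal _).comp (measurable_update_update η₀ c d)

/-- **Bound on the window kernel**: if `F ≤ 1` and `k ≤ 1` then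
`m_F(x, y) ≤ (∫ w)^{#\{c < y' < d\}}` for all `x, y`. [folklore] -/
theorem windowKernel_le_pow (hwm : Measurable w) (hF1 : ∀ σ, F σ ≤ 1) (hk1 : ∀ z z', k z z' ≤ 1)
    (hMK : ∀ x y, MK x y = (∫⋯∫⁻_Finset.Icc (c + 1) (d - 1), (fun σ => F σ *
        (∏ y' ∈ Finset.Icc (c + 1) (d - 1), (w (σ y') * k (σ (y' - 1)) (σ y'))) * k (σ (d - 1)) (σ d))
          ∂fun _ : ℤ => (volume : Measure (ℝ × ℝ)))
            (Function.update (Function.update η₀ c x) d y)) (x y : ℝ × ℝ) :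
    MK x y ≤ (∫⁻ z, w z) ^ (Finset.Icc (c + 1) (d - 1)).card := by
  rw [hMK, ← lmarginal_prod_eq_pow hwm (Finset.Icc (c + 1) (d - 1))
    (Function.update (Function.update η₀ c x) d y)]
  refine lmarginal_mono (fun σ => ?_) _
  simp only []
  calc F σ * (∏ y' ∈ Finset.Icc (c + 1) (d - 1), (w (σ y') * k (σ (y' - 1)) (σ y'))) *
        k (σ (d - 1)) (σ d)
      ≤ 1 * (∏ y' ∈ Finset.Icc (c + 1) (d - 1), (w (σ y') * 1)) * 1 := by
        gcongr
        · exact hF1 σ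
        · exact hk1 _ _
        · exact hk1 _ _
    _ = ∏ y' ∈ Finset.Icc (c + 1) (d - 1), w (σ y') := by simp

/-- **Positivity of the window kernel**: if `F`, `k` and `w` are everywhere positive then so is
`m_F`. [folklore] -/
theorem windowKernel_pos (hkm : Measurable (uncurry k)) (hwm : Measurable w) (hFm : Measurable F)
    (hF0 : ∀ σ, 0 < F σ) (hk0 : ∀ z z', 0 < k z z') (hw0 : ∀ z, 0 < w z)
    (hMK : ∀ x y, MK x y = (∫⋯∫⁻_Finset.Icc (c + 1) (d - 1), (fun σ => F σ *
        (∏ y' ∈ Finset.Icc (c + 1) (d - 1), (w (σ y') * k (σ (y' - 1)) (σ y'))) * k (σ (d - 1)) (σ d))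
          ∂fun _ : ℤ => (volume : Measure (ℝ × ℝ)))
            (Function.update (Function.update η₀ c x) d y)) (x y : ℝ × ℝ) :
    0 < MK x y := by
  rw [hMK]
  unfold lmarginal
  have hcore : Measurable fun σ : ChainConfig => F σ *
      (∏ y' ∈ Finset.Icc (c + 1) (d - 1), (w (σ y') * k (σ (y' - 1)) (σ y'))) * k (σ (d - 1)) (σ d) :=
    (hFm.mul (measurable_blockWeight hkm hwm _)).mul (measurable_kernel_eval hkm _ _)
  have hmeas := hcore.comp (measurable_updateFinset
    (x := Function.update (Function.update η₀ c x) d y) (s := Finset.Icc (c + 1) (d - 1)))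
  refine (lintegral_pos_iff_support hmeas).2 ?_
  have hsupp : Function.support ((fun σ : ChainConfig => F σ *
      (∏ y' ∈ Finset.Icc (c + 1) (d - 1), (w (σ y') * k (σ (y' - 1)) (σ y'))) * k (σ (d - 1)) (σ d)) ∘
        updateFinset (Function.update (Function.update η₀ c x) d y) (Finset.Icc (c + 1) (d - 1))) =
      Set.univ := by
    refine Set.eq_univ_of_forall fun ζ => ?_
    simp only [Function.mem_support, Function.comp_apply]
    exact mul_ne_zero (mul_ne_zero (hF0 _).ne'
      (Finset.prod_ne_zero_iff.2 fun y _ => mul_ne_zero (hw0 _).ne' (hk0 _ _).ne')) (hk0 _ _).ne'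
  rw [hsupp, Measure.pi_univ]
  refine pos_iff_ne_zero.2 (Finset.prod_ne_zero_iff.2 fun i _ => ?_)
  exact (isOpen_univ.measure_pos (volume : Measure (ℝ × ℝ)) univ_nonempty).ne'

end Window

/-! ### `ℝ≥0∞` transfer maps versus real kernel operators on `L²(ρ)` -/

variable {w : ℝ × ℝ → ℝ≥0∞}

/-- **One kernel integration, `ℝ≥0∞` versus real**: for `Ge = ofReal ∘ G` with `G ≥ 0` bounded and
jointly measurable, `f ≥ 0` bounded measurable, and the finite a priori measure `ρ = w · Leb`,
`∫⁻ Ge(x,y) w(y) ofReal(f y) dy = ofReal (∫ G(x,y) f(y) dρ(y))`. [folklore] -/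
theorem lintegral_kernel_weight_ofReal_eq (hwm : Measurable w)
    [IsFiniteMeasure ((volume : Measure (ℝ × ℝ)).withDensity w)]
    {G : ℝ × ℝ → ℝ × ℝ → ℝ} {Ge : ℝ × ℝ → ℝ × ℝ → ℝ≥0∞} (hGe : ∀ x y, Ge x y = ENNReal.ofReal (G x y))
    (hG0 : ∀ x y, 0 ≤ G x y) {C : ℝ} (hGC : ∀ x y, ‖G x y‖ ≤ C) (hGm : StronglyMeasurable (uncurry G))
    {f : ℝ × ℝ → ℝ} (hfm : Measurable f) {B : ℝ} (hfb : ∀ x, ‖f x‖ ≤ B) (hf0 : ∀ x, 0 ≤ f x)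
    (x : ℝ × ℝ) :
    ∫⁻ y, Ge x y * w y * ENNReal.ofReal (f y) =
      ENNReal.ofReal (∫ y, G x y * f y ∂((volume : Measure (ℝ × ℝ)).withDensity w)) := by
  have hGxm : Measurable fun y => G x y :=
    hGm.measurable.comp (measurable_const.prodMk measurable_id)
  have hmeas : Measurable fun y => G x y * f y := hGxm.mul hfm
  have hint : Integrable (fun y => G x y * f y) ((volume : Measure (ℝ × ℝ)).withDensity w) := by
    refine (integrable_const (C * B)).mono' hmeas.aestronglyMeasurable (Eventually.of_forall fun y => ?_)
    rw [norm_mul]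
    exact mul_le_mul (hGC x y) (hfb y) (norm_nonneg _) ((norm_nonneg _).trans (hGC x y))
  rw [ofReal_integral_eq_lintegral_ofReal hint (Eventually.of_forall fun y => mul_nonneg (hG0 x y) (hf0 y)),
    lintegral_withDensity_eq_lintegral_mul _ hwm hmeas.ennreal_ofReal]
  refine lintegral_congr fun y => ?_
  simp only [Pi.mul_apply]
  rw [hGe, ENNReal.ofReal_mul (hG0 x y)]
  ring

/-- **Iterates, `ℝ≥0∞` versus real**: with `k = ofReal ∘ K` (`K ≥ 0` bounded, jointly measurable),
the transfer map `(T g)(z) = ∫⁻ k(z,y) w(y) g(y) dy` and the real kernel operator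
`(κ g)(x) = ∫ K(x,y) g(y) dρ(y)`, `ρ = w · Leb` finite: for `f ≥ 0` bounded measurable and every
`j`, `T^[j] (ofReal ∘ f) = ofReal ∘ κ^[j] f` and `κ^[j] f ≥ 0`. [folklore] -/
theorem iterate_transfer_ofReal_eq (hwm : Measurable w)
    [IsFiniteMeasure ((volume : Measure (ℝ × ℝ)).withDensity w)]
    {K : ℝ × ℝ → ℝ × ℝ → ℝ} {k : ℝ × ℝ → ℝ × ℝ → ℝ≥0∞} (hk : ∀ x y, k x y = ENNReal.ofReal (K x y))
    (hK0 : ∀ x y, 0 ≤ K x y) {C : ℝ} (hKC : ∀ x y, ‖K x y‖ ≤ C) (hKm : StronglyMeasurable (uncurry K))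
    {Tr : (ℝ × ℝ → ℝ≥0∞) → (ℝ × ℝ → ℝ≥0∞)} (hTr : ∀ g z, Tr g z = ∫⁻ y, k z y * w y * g y)
    {f : ℝ × ℝ → ℝ} (hfm : Measurable f) (hfb : ∃ B, ∀ x, ‖f x‖ ≤ B) (hf0 : ∀ x, 0 ≤ f x) (j : ℕ) :
    Tr^[j] (fun y => ENNReal.ofReal (f y)) =
        (fun x => ENNReal.ofReal (((fun g : ℝ × ℝ → ℝ => fun x => ∫ y, K x y * g y
          ∂((volume : Measure (ℝ × ℝ)).withDensity w))^[j] f) x)) ∧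
      ∀ x, 0 ≤ ((fun g : ℝ × ℝ → ℝ => fun x => ∫ y, K x y * g y
          ∂((volume : Measure (ℝ × ℝ)).withDensity w))^[j] f) x := by
  induction j with
  | zero => exact ⟨by simp, by simpa using hf0⟩
  | succ j ih =>
    obtain ⟨hih, hih0⟩ := ih
    obtain ⟨⟨B, hB⟩, hsm⟩ := Literature.Analysis.OperatorTheory.exists_bound_and_measurable_kernelIterate
      (μ := (volume : Measure (ℝ × ℝ)).withDensity w) hKm hKC hfm hfb j
    set g := (fun g : ℝ × ℝ → ℝ => fun x => ∫ y, K x y * g y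
      ∂((volume : Measure (ℝ × ℝ)).withDensity w))^[j] f with hg
    refine ⟨?_, fun x => ?_⟩
    · rw [Function.iterate_succ_apply', Function.iterate_succ_apply', hih, ← hg]
      funext x
      rw [hTr]
      exact lintegral_kernel_weight_ofReal_eq hwm hk hK0 hKC hKm hsm.measurable hB hih0 x
    · rw [Function.iterate_succ_apply', ← hg]
      exact integral_nonneg fun y => mul_nonneg (hK0 x y) (hih0 y)

end OscillatorChain

end Literature.MathematicalPhysics.KineticTheory.HeatConduction

end
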